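import Summits.KontsevichZagierPeriods.KontsevichZagierPeriods.Theorems.TerasomaMultiplicationGammaHodgeSectorStubBetaRelators

/-!
# Crux `BetaCancellation` (stmt-KontsevichZagierPeriods-13633) — ideator 5, round 2: the LEVEL-8 SPECIMEN

First lemmas of the crux idea `level-eight-specimen` (`Cruxes/BetaCancellation/Ideas/level-eight-specimen.md`).

The isolation census of the Beta-word monoid (refuter drefute on crux 3742,
`Cruxes/GammaHodgeSector/NegativeNote-BetaSyzygy.md`) exhibits the SMALLEST place where the crux has
teeth: the level-8 words

  `w  = β(1/8,1/8)·β(3/8,3/8)·β(5/8,7/8)`,   `w' = β(1/8,3/8)·β(1/8,5/8)·β(3/8,7/8)`,   `w = ½·w'` numerically,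

admit NO chain of word moves (symmetry / translation / Dirichlet / units, even with Gauss
multiplication and Euler reflection thrown in), while ONE Beta carrier `z = β(1/4,1/4)` joins them:
`w·z ∼ ½·w'·z` by three Dirichlet re-associations and one translation — an explicit, rational,
catalyst-CONSUMING certificate in dimension 4. Everything smaller (levels ≤ 7, words of length ≤ 2)
is move-connected, so this is the crux's minimal non-vacuous instance.

This file (sorry-free):
* `carrier_identity` — PROVED: `w'·z = κ(q)·(w·z)` in `P = KZ.FormalPeriodRing` for a positive real
  algebraic `q` (in fact `q = 2`), from the tree's `stub_betaRelators` (every relator an honest chain).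
* `levelEightPair_of_betaCancellation` — PROVED: the crux implies `w' = κ(q)·w` (two lines through the
  tree's `betaClass_mem_nonZeroDivisors`). So `LevelEightPair` is a CONSEQUENCE of the crux whose
  hypothesis-side certificate is explicit and whose conclusion is unknown.
* `LevelEightPair` — the research target (unconditional); `LevelEightOneMove` — the single-substitution
  form of the carrier certificate (provable now, M: compose the three Dirichlet charts), the object on
  which the one-move theory of the 0540 census (c14 K6, c15 L3–L7, c16 M3) is to be RUN.
-/

noncomputable section

set_option linter.dupNamespace false

namespace Summit.KontsevichZagierPeriods.KontsevichZagierPeriods.Cruxes.BetaCancellation.LevelEightSpecimen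

open Literature.NumberTheory.Transcendental Literature.NumberTheory.Transcendental.KZ
open Summit.KontsevichZagierPeriods.GammaHodgeSectorKO
open Summit.KontsevichZagierPeriods.KontsevichZagierPeriods.BetaCancellationNegative (betaKernel)
open Summit.KontsevichZagierPeriods.KontsevichZagierPeriods.Theses.TerasomaMultiplication (BetaCancellation)

/-- The isolated level-8 word `w = β(1/8,1/8)·β(3/8,3/8)·β(5/8,7/8)` as a class of `P`. [folklore] -/
def wClass : FormalPeriodRing :=
  betaClass (1/8) (1/8) * betaClass (3/8) (3/8) * betaClass (5/8) (7/8)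

/-- Its partner `w' = β(1/8,3/8)·β(1/8,5/8)·β(3/8,7/8)` (same Γ-class vector, `w = ½ w'`). [folklore] -/
def w'Class : FormalPeriodRing :=
  betaClass (1/8) (3/8) * betaClass (1/8) (5/8) * betaClass (3/8) (7/8)

/-- The minimal carrier `z = β(1/4,1/4)` (value `Γ(¼)²/√π`, a non-unit of `P`). [folklore] -/
def zClass : FormalPeriodRing := betaClass (1/4) (1/4)

/-- **CARRIER IDENTITY (proved).** `w'·z = κ(q)·(w·z)` for a positive real algebraic `q`:
Dirichlet at `(1/8,1/8,1/4)`, `(1/8,1/4,3/8)`, `(1/4,3/8,7/8)`, the translation `β(¼,¼) = κ(q)·β(5/4,¼)`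
and one symmetry — each an honest chain of moves (`stub_betaRelators`). [folklore] -/
theorem carrier_identity : IsConstMultiple (w'Class * zClass) (wClass * zClass) := by
  obtain ⟨hsymm, htrans, -, hdir, -⟩ := stub_betaRelators
  have e1 : betaClass (1/8) (1/8) * betaClass (1/4) (1/4) =
      betaClass (1/8) (1/4) * betaClass (1/8) (3/8) := by
    have h := hdir (1/8) (1/8) (1/4) (by norm_num) (by norm_num) (by norm_num)
    norm_num at h
    exact h
  have e2 : betaClass (1/8) (1/4) * betaClass (3/8) (3/8) =
      betaClass (1/4) (3/8) * betaClass (1/8) (5/8) := by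
    have h := hdir (1/8) (1/4) (3/8) (by norm_num) (by norm_num) (by norm_num)
    norm_num at h
    exact h
  have e3 : betaClass (1/4) (3/8) * betaClass (5/8) (7/8) =
      betaClass (3/8) (7/8) * betaClass (1/4) (5/4) := by
    have h := hdir (1/4) (3/8) (7/8) (by norm_num) (by norm_num) (by norm_num)
    norm_num at h
    exact h
  -- the word identity `w·z = w'·β(1/4,5/4)` (pure commutative-ring bookkeeping)
  have key : wClass * zClass = w'Class * betaClass (1/4) (5/4) := by
    unfold wClass w'Class zClass
    linear_combination (betaClass (3/8) (3/8) * betaClass (5/8) (7/8)) * e1 +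
      (betaClass (1/8) (3/8) * betaClass (5/8) (7/8)) * e2 +
      (betaClass (1/8) (5/8) * betaClass (1/8) (3/8)) * e3
  -- translation + symmetry: `β(1/4,1/4) = κ(q)·β(1/4,5/4)`
  obtain ⟨q, hq, hq0, ht⟩ : IsConstMultiple (betaClass (1/4) (1/4)) (betaClass (5/4) (1/4)) := by
    have h := htrans (1/4) (1/4) (by norm_num) (by norm_num)
    norm_num at h
    exact h
  have hs : betaClass (5/4) (1/4) = betaClass (1/4) (5/4) := hsymm (5/4) (1/4) (by norm_num) (by norm_num)
  refine ⟨q, hq, hq0, ?_⟩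
  calc w'Class * zClass = w'Class * (kap q hq * betaClass (1/4) (5/4)) := by rw [zClass, ht, hs]
    _ = kap q hq * (w'Class * betaClass (1/4) (5/4)) := by ring
    _ = kap q hq * (wClass * zClass) := by rw [key]

/-- **THE RESEARCH TARGET** (unconditional, open): the two level-8 cube integrals agree up to a
positive algebraic constant INSIDE the calculus — `w' = κ(q)·w` in `P`, equivalently
`[∫_{(0,1)³} t₁^{-7/8}(1-t₁)^{-5/8} t₂^{-7/8}(1-t₂)^{-3/8} t₃^{-5/8}(1-t₃)^{-1/8}] ∼ 2·[∫_{(0,1)³} t₁^{-7/8}(1-t₁)^{-7/8} t₂^{-5/8}(1-t₂)^{-5/8} t₃^{-3/8}(1-t₃)^{-1/8}]`.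
No chain is known; word moves provably cannot do it. [cite: KontsevichZagier2001, §1.2 Conjecture 1] -/
def LevelEightPair : Prop := IsConstMultiple w'Class wClass

/-- **Crux ⇒ target** (proved): Beta classes are non-zero-divisors under the crux
(`betaClass_mem_nonZeroDivisors`), so the carrier cancels. [folklore] -/
theorem levelEightPair_of_betaCancellation (hB : BetaCancellation) : LevelEightPair := by
  obtain ⟨q, hq, hq0, h⟩ := carrier_identity
  refine ⟨q, hq, hq0, ?_⟩
  have hz : zClass ∈ nonZeroDivisors FormalPeriodRing := betaClass_mem_nonZeroDivisors hB _ _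
  rw [← mul_assoc] at h
  exact (mul_cancel_right_mem_nonZeroDivisors hz).mp h

/-- Pinning predicate for a 4-fold Beta box `[(0,1)⁴, Π kᵢ(zᵢ)]`. [folklore] -/
def IsBetaBox4 (a₀ b₀ a₁ b₁ a₂ b₂ a₃ b₃ : ℚ) (q : IntegralRep 4) : Prop :=
  q.domain = {z | ∀ i, z i ∈ Set.Ioo (0:ℝ) 1} ∧
  Set.EqOn q.integrand (fun z => betaKernel a₀ b₀ (z 0) * betaKernel a₁ b₁ (z 1) *
    betaKernel a₂ b₂ (z 2) * betaKernel a₃ b₃ (z 3)) q.domain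

/-- **ONE-MOVE FORM of the carrier certificate** (provable now, M-sized: compose the three Dirichlet
charts of `KZDirichletCharts`): the 4-fold box `z ⊗ w` (catalyst `β(¼,¼)` in coordinate 0) is carried
by a SINGLE rule-(2) substitution `Φ = D₃ ∘ D₂ ∘ D₁` — each `Dᵢ(u,v) = (u(1-v)/(1-uv), uv)` acting on the
current catalyst-thread coordinate and one fresh coordinate — onto the box `β(¼,5/4) ⊗ w'` (catalyst
thread ending in the `β(¼,5/4)` slot). The remaining step `β(¼,5/4) = κ(½)·β(¼,¼)` is a one-dimensional
translation tensored with `w'` (ideal property). This `Φ` is the specimen on which the one-move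
descents are to be run: it is rational, catalyst-mixing (not fibre form), of infinite rank.
[cite: AndrewsAskeyRoy1999, Thm 1.8.1] -/
def LevelEightOneMove : Prop :=
  ∀ q : IntegralRep 4, IsBetaBox4 (1/4) (1/4) (1/8) (1/8) (3/8) (3/8) (5/8) (7/8) q →
    ∃ q₂ : IntegralRep 4, IsBetaBox4 (3/8) (7/8) (1/4) (5/4) (1/8) (5/8) (1/8) (3/8) q₂ ∧
      of q - of q₂ ∈ changeOfVariablesRel

/-- Numerical pin of the constant (sanity): `w'/w = Γ(¼)Γ(3/2)/(Γ(½)Γ(5/4)) = 2`, from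
`Γ(x+1) = xΓ(x)` twice; hence the `q` of `carrier_identity` is `2` (`evalP` is a ring hom and
`evalP κ(q) = q`). [folklore] -/
theorem levelEightRatio : evalP w'Class = 2 * evalP wClass := by
  have hG : ∀ x : ℝ, 0 < x → Real.Gamma x ≠ 0 := fun x hx => (Real.Gamma_pos_of_pos hx).ne'
  have h32 : Real.Gamma (3/2 : ℝ) = (1/2 : ℝ) * Real.Gamma (1/2) := by
    rw [show (3/2 : ℝ) = 1/2 + 1 by norm_num, Real.Gamma_add_one (by norm_num)]
  have h54 : Real.Gamma (5/4 : ℝ) = (1/4 : ℝ) * Real.Gamma (1/4) := by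
    rw [show (5/4 : ℝ) = 1/4 + 1 by norm_num, Real.Gamma_add_one (by norm_num)]
  simp only [wClass, w'Class, map_mul, evalP_betaClass _ _ (by norm_num : (0:ℚ) < 1/8)
    (by norm_num : (0:ℚ) < 1/8), evalP_betaClass _ _ (by norm_num : (0:ℚ) < 3/8)
    (by norm_num : (0:ℚ) < 3/8), evalP_betaClass _ _ (by norm_num : (0:ℚ) < 5/8)
    (by norm_num : (0:ℚ) < 7/8), evalP_betaClass _ _ (by norm_num : (0:ℚ) < 1/8)
    (by norm_num : (0:ℚ) < 3/8), evalP_betaClass _ _ (by norm_num : (0:ℚ) < 1/8)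
    (by norm_num : (0:ℚ) < 5/8), evalP_betaClass _ _ (by norm_num : (0:ℚ) < 3/8)
    (by norm_num : (0:ℚ) < 7/8), ProbabilityTheory.beta]
  push_cast
  norm_num
  rw [h32, h54]
  have h1 := hG (1/8) (by norm_num); have h3 := hG (3/8) (by norm_num)
  have h5 := hG (5/8) (by norm_num); have h7 := hG (7/8) (by norm_num)
  have h2 := hG (1/4) (by norm_num); have h4 := hG (1/2) (by norm_num)
  have h6 := hG (3/4) (by norm_num)
  field_simp
  ring

end Summit.KontsevichZagierPeriods.KontsevichZagierPeriods.Cruxes.BetaCancellation.LevelEightSpecimen
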